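import Literature.AnabelianGeometry.EtaleTheta.Discharge.Sec2Rmk261UniversalClosureRefuted
import HarnessLib

/-!
# [EtTh] §2 at the tree's model of `ThetaCovers.TemperedCoverData`: the TWIST automorphisms of `Π^tp_{C̲̲}`
# and of its profinite closure that no endomorphism of `Π^tp_C` (resp. `Π_C`) restricts to
# (part 1 of the refutation of the universal closures of the typed Prop. 2.4 / 2.6 — FACT-LIST F-0609/0610/0611)

S. Mochizuki, *The étale theta function and its Frobenioid-theoretic manifestations*, Publ. RIMS **45**
(2009) [EtTh], §2: Prop. 2.4 (PDF p. 38, printed 264) "any isomorphism of topological groups `Π^tp_{X̲̲_α} ⥲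
Π^tp_{X̲̲_β}` … induces isomorphisms compatible with the various natural maps between the respective `Π^tp`'s",
Prop. 2.6 (p. 40) — the dotted case, and "a similar statement holds when `Π^tp` is replaced by `Π`"
[cite: MochizukiEtTh2009, Prop 2.4 p.38] [cite: MochizukiEtTh2009, Prop 2.6 p.40].

PROOF-ONLY companion (no definition, no new named fact) of abc-iut-w5-d118's MODEL
`ThetaCoversTemperedModelDefs.lean` / `Discharge/Sec2TemperedCoverDataModel.lean` (via abc-iut-f-144's
`Discharge/Sec2Rmk261UniversalClosureRefuted.lean`, whose `PiCuuM_le_ker_Psi` is reused; for every odd `l ≠ 1`: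
`Π^tp_C := (heisPiC l × ℤ/2) × ℤ ↪ Π_C := Â × Ẑ`, `G_K := 1`, `Π_{C̲̲} := Ker·E·⟨ι̲⟩` with the splitting
`S := Ker(Δ_X ↠ Δ̄_X) ⊆ Ker Ψ`, `Ψ` = Tate coordinate mod `l`).  abc-iut cell, block F (fact-proving wave), seat
abc-iut-f-143, tranche 143 (rows F-0609 `TemperedCoverData.Prop24`, F-0610 `…Prop26`, F-0611 `…Prop26_profinite`).
Consumer: `Discharge/Sec2Prop24Prop26ClosureRefuted.lean` (part 2: the inhabitant and `¬ ∀ T, T.Prop24` etc.).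

THE MECHANISM.  In the model the member `C̲̲` has `Π^tp_{C̲̲} = toHat⁻¹(Π_{C̲̲}) ⊆ {Tate coordinate ≡ 0 mod l}`
(`dvd_of_mem_comap_PiCuuM`), contains the CENTRAL element `z := ((thetaEmb 1, 1), 0)` of order `l` (a generator
of `Δ̄_Θ`; `zG_mem_comap_PiCuuM`, `commute_zG`) and the `l`-th power `g^l = ((1,1), l)` of the Tate generator
(`gl_mem_comap_PiCuuM`).  For any subgroup `H` with these three properties the **TWIST**
`γ_z : x ↦ x · z^{n(x)/l}` (`n(x)` = Tate coordinate) is a topological automorphism of `H`, and NO endomorphism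
`Γ` of `Π^tp_C` restricts to it: `Γ(g)^l = γ_z(g^l) = g^l·z` would make `z` an `l`-th power, but in
`heisPiC l = (ℤ/l × ℤ/l) ⋊ D_l` nothing has `l`-th power `z` (`heisPiX` has exponent `l`; an element with a
reflection component keeps it at the odd power `l`) — `pow_ne_thetaEmb_one`, `exists_twist_not_extends`.
Profinite version (`exists_twist_not_extends_hat`): on a subgroup `W ⊆ Â × Ẑ` with `π_l = 1` on the Tate
coordinate, containing `ẑ = (η_A z, 1)` and `(1, η_ℤ l)`, the twist `x ↦ x · ẑ^{π_{l²}(x)/l}` — `π_{l²} : Ẑ → ℤ/l²`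
a continuous extension of `ℤ → ℤ/l²`, congruent to the model's `π_l` mod `l` by density — is a topological
automorphism to which no endomorphism of `Π_C` restricts (read through the retraction `π_A : Â → A`).
HONEST FRAMING: toy bookkeeping over a consistency model; nothing of [EtTh] is asserted or denied; no side is taken
on [IUTchIII] Cor. 3.12; typed ≠ proved.
-/

noncomputable section

namespace Literature.AnabelianGeometry.EtaleTheta

namespace ThetaCovers

namespace TemperedModel

open Multiplicative HeisenbergWitness Literature.AnabelianGeometry.SemiGraphs
  Literature.AnabelianGeometry.EtaleTheta.SettingModel

variable (l : ℕ) [NeZero l]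

/-! ## 1. The finite obstruction: `z = thetaEmb 1` has no `l`-th root -/

omit [NeZero l] in
/-- `z := thetaEmb 1 = ((0,1), 1) ≠ 1` in the toy when `l ≠ 1`. (toy bookkeeping) [cite: MochizukiEtTh2009, Def 2.1 p.36] -/
theorem thetaEmb_one_ne_one (hl1 : l ≠ 1) : thetaEmb l (ofAdd 1) ≠ 1 := by
  intro h
  have h1 : (ofAdd (1 : ZMod l) : Multiplicative (ZMod l)) = ofAdd 0 :=
    thetaEmb_injective l (h.trans (map_one (thetaEmb l)).symm)
  exact hl1 ((ZMod.one_eq_zero_iff (n := l)).mp (Multiplicative.ofAdd.injective h1))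

omit [NeZero l] in
/-- **No `l`-th root.** In the toy `heisPiC l = (ℤ/l × ℤ/l) ⋊ D_l` (`l` odd, `l ≠ 1`) no element has `l`-th power
`z = thetaEmb 1`: an element of `heisPiX` has `l`-th power `1` (`heisPiX` has exponent `l`), and an element with
reflection component `s r^i` keeps that component at the odd power `l`, whereas `z ∈ heisPiX`.
(toy bookkeeping) [cite: MochizukiEtTh2009, Def 2.1 p.36] -/
theorem pow_ne_thetaEmb_one (hl : Odd l) (hl1 : l ≠ 1) (h : heisPiC l) : h ^ l ≠ thetaEmb l (ofAdd 1) := by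
  intro hz
  by_cases hX : h ∈ heisPiX l
  · rw [pow_eq_one l hl hX] at hz
    exact thetaEmb_one_ne_one l hl1 hz.symm
  · have hr : (h ^ l).right = 1 := by rw [hz]; rfl
    rw [← SemidirectProduct.rightHom_eq_right, map_pow, SemidirectProduct.rightHom_eq_right] at hr
    rcases hh : h.right with i | i
    · exact hX ((mem_heisPiX l).mpr ⟨i, hh⟩)
    · rw [hh] at hr
      obtain ⟨k, hk⟩ := hl
      have h3 : DihedralGroup.sr i ^ (2 * k + 1) = DihedralGroup.sr i := by
        rw [pow_succ, pow_mul, pow_two, DihedralGroup.sr_mul_self, one_pow, one_mul]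
      rw [← hk, hr, DihedralGroup.one_def] at h3
      cases h3

/-! ## 2. The twist automorphism on subgroups of `Π^tp_C = (heisPiC l × ℤ/2) × ℤ` -/

omit [NeZero l] in
/-- `z` is central in `Π^tp_C` (`heisTheta` is central in `heisPiC l`; the other factors are commutative).
(toy bookkeeping) [cite: MochizukiEtTh2009, Rmk 2.6.1 p.40] -/
theorem commute_zG (hl : Odd l) (x : GtpM l) :
    Commute x ((TA.mk l (thetaEmb l (ofAdd 1)) 1, 1) : GtpM l) := by
  have hz : thetaEmb l (ofAdd 1) ∈ heisTheta l := by
    rw [heisTheta_eq_range]; exact ⟨ofAdd 1, rfl⟩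
  have hc : x.1.1 * thetaEmb l (ofAdd 1) = thetaEmb l (ofAdd 1) * x.1.1 := by
    have := heis_theta_central l hl x.1.1 hz
    rw [mul_inv_eq_one, mul_inv_eq_iff_eq_mul] at this
    exact this
  show x * _ = _ * x
  refine Prod.ext (Prod.ext ?_ (mul_comm _ _)) (mul_comm _ _)
  exact hc

/-- **The twist.** Let `H ⊆ Π^tp_C` be a subgroup on which the Tate coordinate is divisible by `l`, containing
`z` and the `l`-th power `(1, l)` of the Tate generator.  Then `γ_z : x ↦ x · z^{n(x)/l}` is a topological
automorphism of `H` to which NO endomorphism of `Π^tp_C` restricts (`Γ(1,1)^l = (1,l)·z` would make `z` an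
`l`-th power). This is the mechanism refuting the typed closures of [EtTh] Prop. 2.4 / 2.6 at the model.
(toy bookkeeping) [cite: MochizukiEtTh2009, Prop 2.4 p.38] -/
theorem exists_twist_not_extends (hl : Odd l) (hl1 : l ≠ 1) (H : Subgroup (GtpM l))
    (hA : ∀ x ∈ H, (l : ℤ) ∣ toAdd x.2)
    (hB : ((TA.mk l (thetaEmb l (ofAdd 1)) 1, 1) : GtpM l) ∈ H)
    (hC : (((1 : TA l), ofAdd (l : ℤ)) : GtpM l) ∈ H) :
    ∃ γ : H ≃ₜ* H, ∀ Γ : GtpM l →* GtpM l, ¬ ∀ h : H, Γ h = γ h := by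
  set z : GtpM l := (TA.mk l (thetaEmb l (ofAdd 1)) 1, 1) with hzdef
  have hzc : ∀ x : GtpM l, Commute x z := commute_zG l hl
  have hz2 : ∀ k : ℤ, (z ^ k).2 = 1 := fun k => by
    change z.2 ^ k = 1
    exact one_zpow k
  -- the exponent `n(x)/l`
  let e : GtpM l → ℤ := fun x => toAdd x.2 / (l : ℤ)
  have he_mul : ∀ x y : GtpM l, x ∈ H → e (x * y) = e x + e y := by
    intro x y hx
    change toAdd (x * y).2 / (l : ℤ) = toAdd x.2 / (l : ℤ) + toAdd y.2 / (l : ℤ)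
    rw [Prod.snd_mul, toAdd_mul]
    exact Int.add_ediv_of_dvd_left (hA x hx)
  have he_z : ∀ (x : GtpM l) (k : ℤ), e (x * z ^ k) = e x := by
    intro x k
    change toAdd (x * z ^ k).2 / (l : ℤ) = toAdd x.2 / (l : ℤ)
    rw [Prod.snd_mul, hz2, mul_one]
  have hmem : ∀ (x : H) (k : ℤ), (x : GtpM l) * z ^ k ∈ H := fun x k =>
    H.mul_mem x.2 (H.zpow_mem hB k)
  let γ₀ : H ≃* H :=
    { toFun := fun x => ⟨x.1 * z ^ e x.1, hmem x _⟩
      invFun := fun x => ⟨x.1 * z ^ (-e x.1), hmem x _⟩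
      left_inv := fun x => by
        apply Subtype.ext
        change x.1 * z ^ e x.1 * z ^ (-e (x.1 * z ^ e x.1)) = x.1
        rw [he_z, zpow_neg, mul_inv_cancel_right]
      right_inv := fun x => by
        apply Subtype.ext
        change x.1 * z ^ (-e x.1) * z ^ e (x.1 * z ^ (-e x.1)) = x.1
        rw [he_z, zpow_neg, inv_mul_cancel_right]
      map_mul' := fun x y => by
        apply Subtype.ext
        change (x.1 * y.1) * z ^ e (x.1 * y.1) = x.1 * z ^ e x.1 * (y.1 * z ^ e y.1)
        rw [he_mul _ _ x.2, zpow_add]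
        calc x.1 * y.1 * (z ^ e x.1 * z ^ e y.1) = x.1 * (y.1 * z ^ e x.1) * z ^ e y.1 := by
              simp only [mul_assoc]
          _ = x.1 * (z ^ e x.1 * y.1) * z ^ e y.1 := by rw [((hzc y.1).zpow_right (e x.1)).eq]
          _ = x.1 * z ^ e x.1 * (y.1 * z ^ e y.1) := by simp only [mul_assoc] }
  let γ : H ≃ₜ* H :=
    { γ₀ with
      continuous_toFun := continuous_of_discreteTopology
      continuous_invFun := continuous_of_discreteTopology }
  refine ⟨γ, fun Γ hΓ => ?_⟩
  -- the Tate generator `g = (1, 1)` and its `l`-th power `(1, l) ∈ H`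
  set g : GtpM l := ((1 : TA l), ofAdd (1 : ℤ)) with hgdef
  have hgl : g ^ l = ((1 : TA l), ofAdd (l : ℤ)) := by
    rw [hgdef, Prod.pow_mk, one_pow, ← ofAdd_nsmul, nsmul_one]
  have key : (Γ g) ^ l = g ^ l * z := by
    rw [← map_pow, hgl, hΓ ⟨_, hC⟩]
    change ((1 : TA l), ofAdd (l : ℤ)) * z ^ (toAdd (ofAdd (l : ℤ)) / (l : ℤ)) = _
    rw [toAdd_ofAdd, Int.ediv_self (by exact_mod_cast NeZero.ne l), zpow_one]
  have k1 : ((Γ g) ^ l).1 = TA.mk l (thetaEmb l (ofAdd 1)) 1 := by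
    rw [key, hgl, Prod.fst_mul, one_mul]
  rw [Prod.pow_fst] at k1
  have k2 : ((Γ g).1 ^ l).1 = thetaEmb l (ofAdd 1) := by rw [k1]; rfl
  exact pow_ne_thetaEmb_one l hl hl1 (Γ g).1.1 k2

/-! ## 3. The member `C̲̲` of the model: `Π^tp_{C̲̲} ⊆ {Tate ≡ 0 mod l}`, `z ∈ Π^tp_{C̲̲}`, `g^l ∈ Π^tp_{C̲̲}` -/

/-! (`Π_{C̲̲} ⊆ Ker Ψ` in the model is abc-iut-f-144's `TemperedModel.PiCuuM_le_ker_Psi`,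
`Discharge/Sec2Rmk261UniversalClosureRefuted.lean`, imported.) -/

/-- On `Π^tp_{C̲̲} = toHat⁻¹(Π_{C̲̲})` the Tate coordinate is divisible by `l`. (toy bookkeeping)
[cite: MochizukiEtTh2009, Def 2.5 p.39] -/
theorem dvd_of_mem_comap_PiCuuM {x : GtpM l} (hx : x ∈ (PiCuuM l).comap (toHatM l).toMonoidHom) :
    (l : ℤ) ∣ toAdd x.2 := by
  have h1 : Psi l (toHatM l x) = 1 := PiCuuM_le_ker_Psi l hx
  obtain ⟨a, n⟩ := x
  rw [toHatM_apply, Psi_eta] at h1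
  rw [← ZMod.intCast_zmod_eq_zero_iff_dvd]
  exact Multiplicative.ofAdd.injective h1

/-- `z = ((thetaEmb 1, 1), 0) ∈ Π^tp_{C̲̲}` (its image lies in `Ker(Δ_X ↠ Δ̄_X) = Φ⁻¹(heisTheta) ∩ Ker Ψ ⊆ Π_{C̲̲}`).
(toy bookkeeping) [cite: MochizukiEtTh2009, Def 2.5 p.39] -/
theorem zG_mem_comap_PiCuuM :
    ((TA.mk l (thetaEmb l (ofAdd 1)) 1, 1) : GtpM l) ∈ (PiCuuM l).comap (toHatM l).toMonoidHom := by
  have hz : thetaEmb l (ofAdd 1) ∈ heisTheta l := by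
    rw [heisTheta_eq_range]; exact ⟨ofAdd 1, rfl⟩
  change toHatM l (TA.mk l (thetaEmb l (ofAdd 1)) 1, 1) ∈ PiCuuM l
  refine Subgroup.mem_sup_left (Subgroup.mem_sup_left (Subgroup.mem_inf.mpr ⟨?_, ?_⟩))
  · change Phi l (toHatM l (TA.mk l (thetaEmb l (ofAdd 1)) 1, 1)) ∈ heisTheta l
    rw [toHatM_apply, Phi_eta]
    exact hz
  · rw [MonoidHom.mem_ker, toHatM_apply, Psi_eta, toAdd_one, Int.cast_zero, ofAdd_zero]

/-- `g^l = ((1, 1), l) ∈ Π^tp_{C̲̲}` (its image `(1, η(l))` lies in `Φ⁻¹(heisTheta) ∩ Ker Ψ`).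
(toy bookkeeping) [cite: MochizukiEtTh2009, Def 2.5 p.39] -/
theorem gl_mem_comap_PiCuuM :
    (((1 : TA l), ofAdd (l : ℤ)) : GtpM l) ∈ (PiCuuM l).comap (toHatM l).toMonoidHom := by
  change toHatM l ((1 : TA l), ofAdd (l : ℤ)) ∈ PiCuuM l
  refine Subgroup.mem_sup_left (Subgroup.mem_sup_left (Subgroup.mem_inf.mpr ⟨?_, ?_⟩))
  · change Phi l (toHatM l ((1 : TA l), ofAdd (l : ℤ))) ∈ heisTheta l
    rw [toHatM_apply, Phi_eta]
    exact (heisTheta l).one_mem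
  · rw [MonoidHom.mem_ker, toHatM_apply, Psi_eta, toAdd_ofAdd, Int.cast_natCast, ZMod.natCast_self,
      ofAdd_zero]

/-! ## 4. The profinite twist on subgroups of `Π_C = Â × Ẑ` -/

omit [NeZero l] in
/-- `η_A(z)` is central in `Â` (centralisers are closed; `η_A` has dense range; `z` is central in `A`).
(toy bookkeeping) [cite: MochizukiEtTh2009, Rmk 2.6.1 p.40] -/
theorem commute_eta_zA (hl : Odd l) (X : Ahat l) :
    Commute X (etaCont (TA l) (TA.mk l (thetaEmb l (ofAdd 1)) 1)) := by
  have hd : DenseRange (etaCont (TA l)) :=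
    ProfiniteGrp.ProfiniteCompletion.denseRange (G := GrpCat.of (TA l))
  refine hd.induction_on (p := fun Y => Commute Y (etaCont (TA l) (TA.mk l (thetaEmb l (ofAdd 1)) 1))) X
    (isClosed_eq (continuous_id.mul continuous_const) (continuous_const.mul continuous_id)) ?_
  intro a
  change etaCont (TA l) a * _ = _ * etaCont (TA l) a
  rw [← map_mul, ← map_mul]
  exact congrArg (etaCont (TA l)) (congrArg Prod.fst (commute_zG l hl (a, 1)).eq)

/-- **The profinite twist.** Let `W ⊆ Π_C = Â × Ẑ` be a subgroup on which the Tate coordinate vanishes mod `l`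
(`π_l = 1`), containing `zh = (η_A z, 1)` and `(1, η_ℤ l)`.  Reading the Tate coordinate through a continuous
`π_{l²} : Ẑ → ℤ/l²` (which agrees with `π_l` mod `l`, by density), `x ↦ x · zh^{(π_{l²}(x)/l)}` is a topological
automorphism of `W` to which NO endomorphism of `Π_C` restricts (through the retraction `π_A : Â → A`, `z`
would acquire an `l`-th root in `A`).  This kills the typed profinite clause of [EtTh] Prop. 2.6 at the model.
(toy bookkeeping) [cite: MochizukiEtTh2009, Prop 2.6 p.40] -/
theorem exists_twist_not_extends_hat (hl : Odd l) (hl1 : l ≠ 1) (W : Subgroup (PiCM l))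
    (hA : ∀ x ∈ W, piL l x.2 = 1)
    (hB : ((etaCont (TA l) (TA.mk l (thetaEmb l (ofAdd 1)) 1), 1) : PiCM l) ∈ W)
    (hC : (((1 : Ahat l)), etaCont (Multiplicative ℤ) (ofAdd (l : ℤ))) ∈ W) :
    ∃ γ : W ≃ₜ* W, ∀ Γ : PiCM l →* PiCM l, ¬ ∀ w : W, Γ w = γ w := by
  haveI : NeZero (l * l) := ⟨mul_ne_zero (NeZero.ne l) (NeZero.ne l)⟩
  have h1l : 1 < l := by have := NeZero.ne l; omega
  haveI : Fact (1 < l) := ⟨h1l⟩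
  have hdvd : l ∣ l * l := dvd_mul_right l l
  -- the continuous extension `π_{l²} : Ẑ → ℤ/l²` of `ℤ → ℤ/l²`
  obtain ⟨π₂, hπ₂⟩ := exists_continuousMonoidHom_extend (Multiplicative ℤ) (Multiplicative (ZMod (l * l)))
    (AddMonoidHom.toMultiplicative (Int.castAddHom (ZMod (l * l))))
  have hπ₂' : ∀ n : Multiplicative ℤ,
      π₂ (etaCont (Multiplicative ℤ) n) = ofAdd ((toAdd n : ℤ) : ZMod (l * l)) := fun n => hπ₂ n
  -- `π_{l²} ≡ π_l (mod l)`: two continuous maps to a discrete space agreeing on the dense image of `ℤ`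
  have hcompat : ∀ y : Zhat, (ZMod.cast (toAdd (π₂ y)) : ZMod l) = toAdd (piL l y) := by
    have hd : DenseRange (etaCont (Multiplicative ℤ)) :=
      ProfiniteGrp.ProfiniteCompletion.denseRange (G := GrpCat.of (Multiplicative ℤ))
    have key := hd.equalizer
      ((continuous_of_discreteTopology (f := fun a : Multiplicative (ZMod (l * l)) =>
        (ZMod.cast (toAdd a) : ZMod l))).comp π₂.continuous)
      ((continuous_of_discreteTopology (f := fun a : Multiplicative (ZMod l) => toAdd a)).comp
        (piL l).continuous)
      (funext fun n => by
        change (ZMod.cast (toAdd (π₂ (etaCont _ n))) : ZMod l) = toAdd (piL l (etaCont _ n))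
        rw [hπ₂', piL_eta, toAdd_ofAdd, toAdd_ofAdd, ZMod.cast_intCast hdvd])
    exact fun y => congrFun key y
  -- on `W` the Tate coordinate mod `l²` is a multiple of `l`
  have hval : ∀ x ∈ W, l ∣ (toAdd (π₂ x.2)).val := by
    intro x hx
    have h1 := hcompat x.2
    rw [hA x hx, toAdd_one, ZMod.cast_eq_val] at h1
    exact (ZMod.natCast_eq_zero_iff _ _).mp h1
  -- the central element `zh` of order dividing `l`
  set zh : PiCM l := ((etaCont (TA l) (TA.mk l (thetaEmb l (ofAdd 1)) 1), 1) : PiCM l) with hzhdef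
  have hzhc : ∀ X : PiCM l, Commute X zh := fun X =>
    Prod.ext (commute_eta_zA l hl X.1).eq (by change X.2 * 1 = 1 * X.2; rw [mul_one, one_mul])
  have hz0X : thetaEmb l (ofAdd 1) ∈ heisPiX l :=
    heisTheta_le_heisPiX l (by rw [heisTheta_eq_range]; exact ⟨ofAdd 1, rfl⟩)
  have hzl : zh ^ l = 1 := by
    have hA1 : (TA.mk l (thetaEmb l (ofAdd 1)) 1) ^ l = (1 : TA l) :=
      Prod.ext (pow_eq_one l hl hz0X) (one_pow l)
    rw [hzhdef, Prod.pow_mk, one_pow, ← map_pow, hA1, map_one]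
    rfl
  have hpow : ∀ n : ℕ, zh ^ n = zh ^ (n % l) := fun n => by
    conv_lhs => rw [← Nat.mod_add_div n l, pow_add, pow_mul, hzl, one_pow, mul_one]
  have hpow_add : ∀ a b : ZMod l, zh ^ (a + b).val = zh ^ a.val * zh ^ b.val := fun a b => by
    rw [ZMod.val_add, ← hpow, pow_add]
  -- the exponent `π_{l²}(x) / l ∈ ℤ/l`
  let E : PiCM l → ZMod l := fun x => (((toAdd (π₂ x.2)).val / l : ℕ) : ZMod l)
  have hE_mul : ∀ x y : PiCM l, x ∈ W → y ∈ W → E (x * y) = E x + E y := by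
    intro x y hx hy
    obtain ⟨p, hp⟩ := hval x hx
    obtain ⟨q, hq⟩ := hval y hy
    change ((((toAdd (π₂ (x * y).2)).val / l : ℕ)) : ZMod l) =
      (((toAdd (π₂ x.2)).val / l : ℕ) : ZMod l) + (((toAdd (π₂ y.2)).val / l : ℕ) : ZMod l)
    rw [Prod.snd_mul, map_mul, toAdd_mul, ZMod.val_add, hp, hq, ← mul_add, Nat.mul_mod_mul_left,
      Nat.mul_div_cancel_left _ (NeZero.pos l), Nat.mul_div_cancel_left _ (NeZero.pos l),
      Nat.mul_div_cancel_left _ (NeZero.pos l), ZMod.natCast_mod, Nat.cast_add]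
  have hE_z : ∀ (x : PiCM l) (k : ℕ), E (x * zh ^ k) = E x := by
    intro x k
    change ((((toAdd (π₂ (x * zh ^ k).2)).val / l : ℕ)) : ZMod l) = (((toAdd (π₂ x.2)).val / l : ℕ) : ZMod l)
    rw [Prod.snd_mul, Prod.pow_snd, hzhdef, one_pow, mul_one]
  have hmem : ∀ (x : W) (k : ℕ), (x : PiCM l) * zh ^ k ∈ W := fun x k => W.mul_mem x.2 (W.pow_mem hB k)
  let γ₀ : W ≃* W :=
    { toFun := fun x => ⟨x.1 * zh ^ (E x.1).val, hmem x _⟩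
      invFun := fun x => ⟨x.1 * zh ^ (-E x.1).val, hmem x _⟩
      left_inv := fun x => by
        apply Subtype.ext
        change x.1 * zh ^ (E x.1).val * zh ^ (-E (x.1 * zh ^ (E x.1).val)).val = x.1
        rw [hE_z, mul_assoc, ← hpow_add, add_neg_cancel, ZMod.val_zero, pow_zero, mul_one]
      right_inv := fun x => by
        apply Subtype.ext
        change x.1 * zh ^ (-E x.1).val * zh ^ (E (x.1 * zh ^ (-E x.1).val)).val = x.1
        rw [hE_z, mul_assoc, ← hpow_add, neg_add_cancel, ZMod.val_zero, pow_zero, mul_one]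
      map_mul' := fun x y => by
        apply Subtype.ext
        change (x.1 * y.1) * zh ^ (E (x.1 * y.1)).val = x.1 * zh ^ (E x.1).val * (y.1 * zh ^ (E y.1).val)
        rw [hE_mul _ _ x.2 y.2, hpow_add]
        calc x.1 * y.1 * (zh ^ (E x.1).val * zh ^ (E y.1).val)
            = x.1 * (y.1 * zh ^ (E x.1).val) * zh ^ (E y.1).val := by simp only [mul_assoc]
          _ = x.1 * (zh ^ (E x.1).val * y.1) * zh ^ (E y.1).val := by
              rw [((hzhc y.1).pow_right (E x.1).val).eq]
          _ = x.1 * zh ^ (E x.1).val * (y.1 * zh ^ (E y.1).val) := by simp only [mul_assoc] }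
  have hcont : ∀ f : Multiplicative (ZMod (l * l)) → ℕ,
      Continuous fun x : W => (x : PiCM l) * zh ^ f (π₂ x.1.2) := fun f =>
    continuous_subtype_val.mul
      ((continuous_of_discreteTopology (f := fun a : Multiplicative (ZMod (l * l)) => zh ^ f a)).comp
        (π₂.continuous.comp (continuous_snd.comp continuous_subtype_val)))
  let γ : W ≃ₜ* W :=
    { γ₀ with
      continuous_toFun := by
        apply Continuous.subtype_mk
        exact hcont fun a => ((((toAdd a).val / l : ℕ) : ZMod l)).val
      continuous_invFun := by
        apply Continuous.subtype_mk
        exact hcont fun a => (-(((toAdd a).val / l : ℕ) : ZMod l)).val }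
  refine ⟨γ, fun Γ hΓ => ?_⟩
  -- the Tate generator `gh = (1, η_ℤ 1)`; `gh^l ∈ W` and `γ(gh^l) = gh^l · zh`
  set gh : PiCM l := ((1 : Ahat l), etaCont (Multiplicative ℤ) (ofAdd (1 : ℤ))) with hghdef
  have hghl : gh ^ l = ((1 : Ahat l), etaCont (Multiplicative ℤ) (ofAdd (l : ℤ))) := by
    rw [hghdef, Prod.pow_mk, one_pow, ← map_pow, ← ofAdd_nsmul, nsmul_one]
  have hmemgl : gh ^ l ∈ W := by rw [hghl]; exact hC
  have hll : l < l * l := by nlinarith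
  have hE1 : E (gh ^ l) = 1 := by
    rw [hghl]
    change ((((toAdd (π₂ (etaCont (Multiplicative ℤ) (ofAdd (l : ℤ))))).val / l : ℕ)) : ZMod l) = 1
    rw [hπ₂', toAdd_ofAdd, toAdd_ofAdd, Int.cast_natCast, ZMod.val_natCast, Nat.mod_eq_of_lt hll,
      Nat.div_self (NeZero.pos l), Nat.cast_one]
  have key : (Γ gh) ^ l = gh ^ l * zh := by
    rw [← map_pow, hΓ ⟨gh ^ l, hmemgl⟩]
    change gh ^ l * zh ^ (E (gh ^ l)).val = _
    rw [hE1, ZMod.val_one, pow_one]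
  have k1 : ((Γ gh) ^ l).1 = etaCont (TA l) (TA.mk l (thetaEmb l (ofAdd 1)) 1) := by
    rw [key, hghl, Prod.fst_mul, one_mul]
  rw [Prod.pow_fst] at k1
  have k2 : (piA l (Γ gh).1) ^ l = TA.mk l (thetaEmb l (ofAdd 1)) 1 := by
    rw [← map_pow, k1, piA_eta]
  have k3 : ((piA l (Γ gh).1) ^ l).1 = thetaEmb l (ofAdd 1) := by rw [k2]; rfl
  exact pow_ne_thetaEmb_one l hl hl1 (piA l (Γ gh).1).1 k3

end TemperedModel

end ThetaCovers

end Literature.AnabelianGeometry.EtaleTheta
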